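import Mathlib
import Summits.Ventures.PercRepro2.SwOutCrossJunctionRead
import Summits.Ventures.PercRepro2.SwOutCrossJunctionAttToggle
import Summits.Ventures.PercRepro2.SwOutMixedPartOrbitDefs
import Summits.Ventures.PercRepro2.SwOutSevThmDefs

/-!
# The flip of an arm-closed set of a block point is a block point, I: the toggled point (blind
cell PercRepro2, night-4 g24, 2026-08-28; proofs/NIGHT4-G24.md §6)

For a cross base `σ`, a non-leaking point `q` of its cube and an ARM-CLOSED set `W` of the
realisation (a union of coarse arms of `hull h`), the toggled point `toggleX q W` flips the classes
inside `W` (the far arms inside `W`; with `u ∈ W` every u-arm, every u–`p i` edge, and the cross and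
outside edges of the dropped vertices inside `W`).  THE FLIP IDENTITY `flip_armClosed_eq_crossReal`:
the flip of `W` is the realisation of the toggled point — an arm-closed set contains or misses every
arm (`subset_or_disjoint_of_armClosed`), contains the u-arms iff it contains `u` (`U_subset_iff_X`),
and a dropped vertex only with `u` (`u_mem_of_p_mem_X`).  The fibre side (`attToggle`,
`attE_attToggle_flip`) is in `SwOutCrossJunctionAttToggle`.
-/

namespace Summit.Ventures.PercRepro2

namespace CrossArm

open Hull LocRows

variable {V : Type*} {E : Type*}

open scoped Classical

section Toggle

variable {ι X κ : Type*} {G : SimpleGraph X}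

/-- The toggled point: the classes inside `W` flipped. -/
noncomputable def toggleX (u : V) (p : X → V) (F : κ → Set V) (q : PtXG ι κ X G) (W : Set V) :
    PtXG ι κ X G :=
  (fun k => if F k ⊆ W then !q.1 k else q.1 k,
    fun j => if u ∈ W then !q.2.1 j else q.2.1 j,
    fun i => if u ∈ W then !q.2.2.1 i else q.2.2.1 i,
    fun s => if ∃ i ∈ s.1, p i ∈ W then !q.2.2.2.1 s else q.2.2.2.1 s,
    fun i => if p i ∈ W then !q.2.2.2.2 i else q.2.2.2.2 i)

end Toggle

section Flip

variable {ends : E → Sym2 V} {σ : Config E} {h u : V} {ι X κ : Type*} {U : ι → Set V}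
  {p : X → V} {G : SimpleGraph X} {F : κ → Set V} (hb : CrossBase ends σ h u U p G F)
  (hup : ∀ i, ∃ e, ends e = s(u, p i)) (hcross : ∀ i j, G.Adj i j → ∃ e, ends e = s(p i, p j))
  (hconnU : ∀ j, ∀ x ∈ U j, ∀ y ∈ U j, y ∈ cluster ends (fun e => decide (e ∈ within ends (U j))) x)
  (hconnF : ∀ k, ∀ x ∈ F k, ∀ y ∈ F k, y ∈ cluster ends (fun e => decide (e ∈ within ends (F k))) x)
  {q : PtXG ι κ X G} (hqR : ¬ LeakRX G q) (hqB : ¬ LeakBX G q)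
  {W : Set V} (hW : ArmClosed ends (crossReal ends u U p G F σ q) h W)
include hb hup hcross hqR hqB hW hconnU hconnF

omit hW hconnU hconnF in
/-- A vertex of a u-arm lies in the hull of `h` at the realisation. -/
lemma CrossBase.U_mem_hull {j : ι} {x : V} (hx : x ∈ U j) :
    x ∈ hull ends (crossReal ends u U p G F σ q) h := by
  cases hj : q.2.1 j with
  | true =>
    left
    rw [hb.cluster_crossReal hup hcross hqR, mem_redSetX_iff]
    exact Or.inr (Or.inl ⟨j, hj, hx⟩)
  | false =>
    right
    rw [hb.cluster_blue_crossReal hup hcross hqB, mem_redSetX_iff]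
    exact Or.inr (Or.inl ⟨j, by simp [flipXG, flipAll, hj], hx⟩)

omit hW hconnU hconnF in
/-- A vertex of a far arm lies in the hull of `h` at the realisation. -/
lemma CrossBase.F_mem_hull {k : κ} {x : V} (hx : x ∈ F k) :
    x ∈ hull ends (crossReal ends u U p G F σ q) h := by
  cases hk : q.1 k with
  | true =>
    left
    rw [hb.cluster_crossReal hup hcross hqR, mem_redSetX_iff]
    exact Or.inr (Or.inr (Or.inr (Or.inr ⟨k, hk, hx⟩)))
  | false =>
    right
    rw [hb.cluster_blue_crossReal hup hcross hqB, mem_redSetX_iff]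
    exact Or.inr (Or.inr (Or.inr (Or.inr ⟨k, by simp [flipXG, flipAll, hk], hx⟩)))

omit hW hconnU hconnF in
/-- `u` lies in the hull of `h` at the realisation (some u-arm exists). -/
lemma CrossBase.u_mem_hull_X [Nonempty ι] : u ∈ hull ends (crossReal ends u U p G F σ q) h := by
  let j : ι := Classical.arbitrary ι
  cases hj : q.2.1 j with
  | true =>
    left
    rw [hb.cluster_crossReal hup hcross hqR, mem_redSetX_iff]
    exact Or.inr (Or.inr (Or.inl ⟨rfl, j, hj⟩))
  | false =>
    right
    rw [hb.cluster_blue_crossReal hup hcross hqB, mem_redSetX_iff]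
    exact Or.inr (Or.inr (Or.inl ⟨rfl, j, by simp [flipXG, flipAll, hj]⟩))

omit hconnF in
/-- An arm-closed set contains or misses every u-arm. -/
lemma CrossBase.U_subset_or_disjoint (j : ι) : U j ⊆ W ∨ ∀ x ∈ U j, x ∉ W :=
  BigBlock.subset_or_disjoint_of_armClosed hW
    (fun _ hx => ⟨hb.U_mem_hull hup hcross hqR hqB hx, fun h' => hb.h_notMem_U j (h' ▸ hx)⟩)
    (hconnU j)

omit hconnU in
/-- An arm-closed set contains or misses every far arm. -/
lemma CrossBase.F_subset_or_disjoint (k : κ) : F k ⊆ W ∨ ∀ x ∈ F k, x ∉ W :=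
  BigBlock.subset_or_disjoint_of_armClosed hW
    (fun _ hx => ⟨hb.F_mem_hull hup hcross hqR hqB hx, fun h' => hb.h_notMem_F k (h' ▸ hx)⟩)
    (hconnF k)

omit hconnF in
/-- **An arm-closed set contains a u-arm iff it contains `u`.** -/
lemma CrossBase.U_subset_iff_X [Nonempty ι] (j : ι) : U j ⊆ W ↔ u ∈ W := by
  obtain ⟨e, x, hex, hx⟩ := hb.u_adj_U j
  have hxH := hb.U_mem_hull hup hcross hqR hqB hx
  have hxh : x ≠ h := fun h' => hb.h_notMem_U j (h' ▸ hx)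
  have huH := hb.u_mem_hull_X hup hcross hqR hqB
  constructor
  · intro hsub
    exact hW.closed e x u (ends_swap hex) (hsub hx) huH hb.hne_hu.symm
  · intro huW
    rcases hb.U_subset_or_disjoint hup hcross hconnU hqR hqB hW j with hsub | hdisj
    · exact hsub
    · exact absurd (hW.closed e u x hex huW hxH hxh) (hdisj x hx)

omit hconnU hconnF in
/-- An arm-closed set contains a dropped vertex only with `u`. -/
lemma CrossBase.u_mem_of_p_mem_X {i : X} (hp : p i ∈ W) : u ∈ W := by
  obtain ⟨e, he⟩ := hup i
  have huH : u ∈ hull ends (crossReal ends u U p G F σ q) h := by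
    have hpH := (hW.subset (p i) hp).1
    -- `u` is adjacent to `p i`, which lies in the hull: `u` is in the hull as well
    rcases hb.hull_crossReal_subset hup hcross hqR hqB hpH with h' | h' | ⟨i', h'⟩ | h'
    · exact absurd h' (hb.hne_hp i).symm
    · exact absurd h' (hb.hne_up i).symm
    · -- `p i` is in the hull through its edge to `u` or a cross edge: the hull formulas put `u` in
      rcases hpH with hpR | hpB
      · rw [hb.cluster_crossReal hup hcross hqR, mem_redSetX_iff] at hpR
        rcases hpR with h'' | ⟨j, -, h''⟩ | ⟨h'', -⟩ | ⟨i'', -, hs, -⟩ | ⟨k, -, h''⟩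
        · exact absurd h'' (hb.hne_hp i).symm
        · exact absurd h'' (hb.p_notMem_U i j)
        · exact absurd h'' (hb.hne_up i).symm
        · left
          rw [hb.cluster_crossReal hup hcross hqR, mem_redSetX_iff]
          exact Or.inr (Or.inr (Or.inl ⟨rfl, hs⟩))
        · exact absurd h'' (hb.p_notMem_F i k)
      · rw [hb.cluster_blue_crossReal hup hcross hqB, mem_redSetX_iff] at hpB
        rcases hpB with h'' | ⟨j, -, h''⟩ | ⟨h'', -⟩ | ⟨i'', -, hs, -⟩ | ⟨k, -, h''⟩
        · exact absurd h'' (hb.hne_hp i).symm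
        · exact absurd h'' (hb.p_notMem_U i j)
        · exact absurd h'' (hb.hne_up i).symm
        · right
          rw [hb.cluster_blue_crossReal hup hcross hqB, mem_redSetX_iff]
          exact Or.inr (Or.inr (Or.inl ⟨rfl, hs⟩))
        · exact absurd h'' (hb.p_notMem_F i k)
    · exfalso
      rcases mem_armsAllX_iff.1 h' with ⟨j, hj⟩ | ⟨k, hk⟩
      · exact hb.p_notMem_U i j hj
      · exact hb.p_notMem_F i k hk
  exact hW.closed e (p i) u (ends_swap he) hp huH hb.hne_hu.symm

omit hconnU hconnF in
/-- A vertex outside the structure is not in an arm-closed set. -/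
lemma CrossBase.notMem_W_of_out {y : V} (hyh : y ≠ h) (hyu : y ≠ u) (hyp : ∀ i, y ≠ p i)
    (hy : y ∉ armsAllX U F) : y ∉ W := by
  intro hyW
  rcases hb.hull_crossReal_subset hup hcross hqR hqB (hW.subset y hyW).1 with h' | h' | ⟨i, h'⟩ | h'
  · exact hyh h'
  · exact hyu h'
  · exact hyp i h'
  · exact hy h'

/-- **THE FLIP IDENTITY**: the flip of an arm-closed set is the realisation of the toggled
point. -/
theorem CrossBase.flip_armClosed_eq_crossReal [Nonempty ι] :
    flip ends W (crossReal ends u U p G F σ q) =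
      crossReal ends u U p G F σ (toggleX u p F q W) := by
  funext e
  by_cases hF : ∃ k, e ∈ touches ends (F k)
  · obtain ⟨k, hk⟩ := hF
    obtain ⟨x, y, hxy, hx, hy⟩ := hb.ends_of_touches_F hk
    rcases hb.F_subset_or_disjoint hup hcross hconnF hqR hqB hW k with hsub | hdisj
    · rw [flip_apply_of_mem ⟨x, hsub hx, y, hxy⟩, hb.crossReal_apply_F hk, hb.crossReal_apply_F hk]
      simp only [toggleX, if_pos hsub]
      cases q.1 k <;> simp
    · have hnt : e ∉ touches ends W := by
        rintro ⟨z, hz, w, hzw⟩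
        rw [hxy, Sym2.eq_iff] at hzw
        have hzx : z = x ∨ z = y := by
          rcases hzw with ⟨h1, -⟩ | ⟨-, h2⟩
          · exact Or.inl h1.symm
          · exact Or.inr h2.symm
        rcases hzx with rfl | rfl
        · exact hdisj z hx hz
        · rcases hy with hy | rfl | ⟨hyh, hyu, hyp, hyA⟩
          · exact hdisj z hy hz
          · exact (hW.subset z hz).2 rfl
          · exact hb.notMem_W_of_out hup hcross hqR hqB hW hyh hyu hyp hyA hz
      rw [flip_apply_of_notMem hnt, hb.crossReal_apply_F hk, hb.crossReal_apply_F hk]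
      simp only [toggleX, if_neg (show ¬ F k ⊆ W from fun hsub => hdisj x hx (hsub hx))]
  by_cases hU : ∃ j, e ∈ touches ends (U j)
  · obtain ⟨j, hj⟩ := hU
    obtain ⟨x, y, hxy, hx, hy⟩ := hb.ends_of_touches_U hj
    by_cases huW : u ∈ W
    · have hsub : U j ⊆ W := (hb.U_subset_iff_X hup hcross hconnU hqR hqB hW j).2 huW
      rw [flip_apply_of_mem ⟨x, hsub hx, y, hxy⟩, hb.crossReal_apply_U hj, hb.crossReal_apply_U hj]
      simp only [toggleX, if_pos huW]
      cases q.2.1 j <;> simp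
    · have hdisj : ∀ z ∈ U j, z ∉ W := fun z hz hzW =>
        huW ((hb.U_subset_iff_X hup hcross hconnU hqR hqB hW j).1 (by
          rcases hb.U_subset_or_disjoint hup hcross hconnU hqR hqB hW j with hsub | hdisj
          · exact hsub
          · exact absurd hzW (hdisj z hz)))
      have hnt : e ∉ touches ends W := by
        rintro ⟨z, hz, w, hzw⟩
        rw [hxy, Sym2.eq_iff] at hzw
        have hzx : z = x ∨ z = y := by
          rcases hzw with ⟨h1, -⟩ | ⟨-, h2⟩
          · exact Or.inl h1.symm
          · exact Or.inr h2.symm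
        rcases hzx with rfl | rfl
        · exact hdisj z hx hz
        · rcases hy with hy | rfl | rfl | ⟨hyh, hyu, hyp, hyA⟩
          · exact hdisj z hy hz
          · exact (hW.subset z hz).2 rfl
          · exact huW hz
          · exact hb.notMem_W_of_out hup hcross hqR hqB hW hyh hyu hyp hyA hz
      rw [flip_apply_of_notMem hnt, hb.crossReal_apply_U hj, hb.crossReal_apply_U hj]
      simp only [toggleX, if_neg huW]
  by_cases hUP : ∃ i, e ∈ clsUPX ends u p i
  · obtain ⟨i, hi⟩ := hUP
    have he : ends e = s(u, p i) := hi
    by_cases huW : u ∈ W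
    · rw [flip_apply_of_mem ⟨u, huW, p i, he⟩, hb.crossReal_apply_UP hi, hb.crossReal_apply_UP hi]
      simp only [toggleX, if_pos huW]
      cases q.2.2.1 i <;> simp
    · have hnt : e ∉ touches ends W := by
        rintro ⟨z, hz, w, hzw⟩
        rw [he, Sym2.eq_iff] at hzw
        rcases hzw with ⟨h1, -⟩ | ⟨-, h2⟩
        · exact huW (h1 ▸ hz)
        · exact huW (hb.u_mem_of_p_mem_X hup hcross hqR hqB hW (h2 ▸ hz))
      rw [flip_apply_of_notMem hnt, hb.crossReal_apply_UP hi, hb.crossReal_apply_UP hi]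
      simp only [toggleX, if_neg huW]
  by_cases hC : ∃ s, e ∈ clsCX ends p G s
  · obtain ⟨s, hs⟩ := hC
    obtain ⟨i, j, hsij, he⟩ := hs
    by_cases hW' : ∃ i ∈ s.1, p i ∈ W
    · obtain ⟨i', hi', hpW⟩ := hW'
      have hmem : e ∈ touches ends W := by
        rw [hsij] at hi'
        rcases Sym2.mem_iff.1 hi' with rfl | rfl
        · exact ⟨p i', hpW, p j, he⟩
        · exact ⟨p i', hpW, p i, ends_swap he⟩
      rw [flip_apply_of_mem hmem, hb.crossReal_apply_C ⟨i, j, hsij, he⟩,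
        hb.crossReal_apply_C ⟨i, j, hsij, he⟩]
      simp only [toggleX, if_pos (show ∃ i ∈ s.1, p i ∈ W from ⟨i', hi', hpW⟩)]
      cases q.2.2.2.1 s <;> simp
    · have hnt : e ∉ touches ends W := by
        rintro ⟨z, hz, w, hzw⟩
        rw [he, Sym2.eq_iff] at hzw
        rcases hzw with ⟨h1, -⟩ | ⟨-, h2⟩
        · exact hW' ⟨i, by rw [hsij]; exact Sym2.mem_mk_left _ _, h1 ▸ hz⟩
        · exact hW' ⟨j, by rw [hsij]; exact Sym2.mem_mk_right _ _, h2 ▸ hz⟩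
      rw [flip_apply_of_notMem hnt, hb.crossReal_apply_C ⟨i, j, hsij, he⟩,
        hb.crossReal_apply_C ⟨i, j, hsij, he⟩]
      simp only [toggleX, if_neg hW']
  by_cases hX : ∃ i, e ∈ clsExtX ends u p i
  · obtain ⟨i, hi⟩ := hX
    obtain ⟨x, he, hxu, hxp⟩ := hi
    have hxW : x ∉ W := by
      rcases hb.p_edges i e x he with h' | ⟨j, h', -⟩ | ⟨hxh, -, -, hxA⟩
      · exact absurd h' hxu
      · exact absurd h' (hxp j)
      · exact hb.notMem_W_of_out hup hcross hqR hqB hW hxh hxu hxp hxA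
    by_cases hpW : p i ∈ W
    · rw [flip_apply_of_mem ⟨p i, hpW, x, he⟩, hb.crossReal_apply_Ext ⟨x, he, hxu, hxp⟩,
        hb.crossReal_apply_Ext ⟨x, he, hxu, hxp⟩]
      simp only [toggleX, if_pos hpW]
      cases q.2.2.2.2 i <;> simp
    · have hnt : e ∉ touches ends W := by
        rintro ⟨z, hz, w, hzw⟩
        rw [he, Sym2.eq_iff] at hzw
        rcases hzw with ⟨h1, -⟩ | ⟨-, h2⟩
        · exact hpW (h1 ▸ hz)
        · exact hxW (h2 ▸ hz)
      rw [flip_apply_of_notMem hnt, hb.crossReal_apply_Ext ⟨x, he, hxu, hxp⟩,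
        hb.crossReal_apply_Ext ⟨x, he, hxu, hxp⟩]
      simp only [toggleX, if_neg hpW]
  · simp only [not_exists] at hF hU hUP hC hX
    have hnt : e ∉ touches ends W := by
      rintro ⟨x, hx, y, hxy⟩
      rcases hb.hull_crossReal_subset hup hcross hqR hqB (hW.subset x hx).1 with rfl | rfl | ⟨i, rfl⟩ | hxA
      · exact (hW.subset x hx).2 rfl
      · rcases hb.u_edges e y hxy with ⟨j, hy⟩ | ⟨i, rfl⟩
        · exact hU j ⟨y, hy, x, ends_swap hxy⟩
        · exact hUP i hxy
      · rcases hb.p_edges i e y hxy with rfl | ⟨j, rfl, hadj⟩ | ⟨-, hyu, hyp, -⟩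
        · exact hUP i (ends_swap hxy)
        · exact hC ⟨s(i, j), G.mem_edgeSet.2 hadj⟩ ⟨i, j, rfl, hxy⟩
        · exact hX i ⟨y, hxy, hyu, hyp⟩
      · rcases mem_armsAllX_iff.1 hxA with ⟨j, hj⟩ | ⟨k, hk⟩
        · exact hU j ⟨x, hj, y, hxy⟩
        · exact hF k ⟨x, hk, y, hxy⟩
    rw [flip_apply_of_notMem hnt, CrossBase.crossReal_apply_none hF hU hUP hC hX,
      CrossBase.crossReal_apply_none hF hU hUP hC hX]

end Flip

end CrossArm

end Summit.Ventures.PercRepro2
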